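import Literature.MathematicalPhysics.QuantumFieldTheory.Balaban1983to89.B3WT226Pairings
import Literature.MathematicalPhysics.QuantumFieldTheory.Balaban1983to89.B3WTCovariance

/-!
# `Balaban1983to89.B3WTWick` — T. Bałaban, *(Higgs)₂,₃ quantum fields in a finite volume. III. Renormalization*,
# Commun. Math. Phys. **88** (1983) 411–445 [Balaban1983Higgs3], (2.26) p. 431: the fourth moments of `dμ_{C^η_{M²}}` (Wick's
# theorem for four fields) and the two-propagator contraction `∫dμ_C ⟪φ(x₁),qφ(y₁)⟫⟪φ(x₂),qφ(y₂)⟫` ON THE CONCRETE LATTICE MODEL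

statement-level skeleton of published theorems with citation tags; proofs where landed; nothing here is a claim about the Yang–Mills mass gap

Page 431 [PDF 21] (image render `run/shared/lean/pub/pub-balaban/b2b-balaban-ref1/pages/1983-cmp88-higgs23-III/…-p021-x2.png`),
(2.26): *"… calculating the Gaussian integrals … we get −e_kΣ_{b,b'}η^{2d}A_b tr q(C^η_{M²}∂^{η*})(b₋,b')q(C^η_{M²}∂^{η*})(b'₋,b)(∂^ηλ)(b')
+ e_kΣ_{b,b'}η^{2d}A_b tr qC^η_{M²}(b₋,b'₋)q(∂^ηC^η_{M²}∂^{η*})(b',b)(∂^ηλ)(b') − …"* — the two-propagator terms are the Wick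
contractions of the product `⟨∂^ηφ,Aqφ⟩·:⟨∂^ηφ,∂^ηλqφ⟩:` of quadratic functionals.  THIS FILE proves, for the lattice model of
`…B3WT223Instance` with the propagator `C^η_{M²} = B3WTPropagator.G` of `…B3WTCovariance`:
* `moment4` — **Wick's theorem for four fields**: `∫dφ e^{−½⟨φ,Kφ⟩}ℓ₁ℓ₂ℓ₃ℓ₄ = Z(c₁₂c₃₄ + c₁₃c₂₄ + c₁₄c₂₃)` for the linear
  functionals `ℓ_a(φ) = ⟪φ(x_a),v_a⟫`, `c_{ab} = C^η_{M²}(x_a,x_b)⟪v_a,v_b⟫`, by one more Gaussian integration by parts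
  (`B3WTCovariance.gaussIBP` with the cubic `g = ℓ₂ℓ₃ℓ₄`) on top of the covariance `B3WTCovariance.moment2`;
* `moment_qq` — **the `q`-contraction**: `∫dφ e^{−½⟨φ,Kφ⟩}⟪φ(x₁),qφ(y₁)⟫⟪φ(x₂),qφ(y₂)⟫
  = Z·tr q²·(C(x₁,y₂)C(y₁,x₂) − C(x₁,x₂)C(y₁,y₂))`: the self-contractions vanish (`⟪e,qe⟫ = 0`, antisymmetry of `q`, B1 p. 605 —
  the normal ordering `: :` and (2.25)), the two cross contractions carry `tr(qq^*) = −tr q²` and `tr(qq) = tr q²`.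
Phase-2 RESERVE R11 (part 2b) of `PHASE2-TARGETS.md` §G.3; cell `lit-balaban`, seat p39 (gen 2, unit `lit-balaban-p39`), HOME
`run/shared/lean/pub/lit-balaban/`.  Nothing beyond these lattice identities is asserted; no new `Prop` is introduced.
-/

noncomputable section

open scoped BigOperators InnerProductSpace

namespace Literature.MathematicalPhysics.QuantumFieldTheory.Balaban1983to89.B3WTWick

open _root_.MeasureTheory Matrix
open LatticeFieldCalculus B3WT223Instance B3WT224Instance B3WT226Pairings B3WTPropagator B3WTCovariance

variable {P : Params} {j N : ℕ} (C : HiggsLattice.ChargeData N) (η w c M2 : ℝ)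

/-! ## §1 Growth and integrability of products of linear functionals -/

/-- `|⟪φ(x),v⟫| ≤ |v|·sup|φ|`. [cite: Balaban1983Higgs3, (2.26) p.431] -/
theorem abs_inner_apply_le (φ : Cfg P j N) (x : Site P j) (v : EuclideanSpace ℝ (Fin N)) : |⟪φ x, v⟫_ℝ| ≤ ‖v‖ * ‖φ‖ :=
  (abs_real_inner_le_norm _ _).trans (by rw [mul_comm]; exact mul_le_mul_of_nonneg_left (norm_le_pi_norm φ x) (norm_nonneg _))

/-- `sup|φ|^n ≤ e^{n·sup|φ|}`. [folklore] -/
private theorem pow_norm_le_exp (φ : Cfg P j N) (n : ℕ) : ‖φ‖ ^ n ≤ Real.exp (n * ‖φ‖) := by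
  have h1 : ‖φ‖ ≤ Real.exp ‖φ‖ := by linarith [Real.add_one_le_exp ‖φ‖]
  calc ‖φ‖ ^ n ≤ Real.exp ‖φ‖ ^ n := pow_le_pow_left₀ (norm_nonneg _) h1 n
    _ = Real.exp (n * ‖φ‖) := by rw [← Real.exp_nat_mul]

/-- `e^{−½⟨φ,Kφ⟩}ℓ₁ℓ₂ℓ₃ℓ₄` is integrable. [cite: Balaban1983Higgs3, (2.26) p.431] -/
theorem integrable_weight_mul_inner4 (hw : 0 < w) (hM : 0 < M2) (x₁ x₂ x₃ x₄ : Site P j)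
    (v₁ v₂ v₃ v₄ : EuclideanSpace ℝ (Fin N)) :
    Integrable (fun φ => weight C η w c M2 (0 : VecField P j ℝ) φ *
      (⟪φ x₁, v₁⟫_ℝ * (⟪φ x₂, v₂⟫_ℝ * (⟪φ x₃, v₃⟫_ℝ * ⟪φ x₄, v₄⟫_ℝ)))) := by
  refine integrable_weight_mul C η w c M2 hw hM
    (((continuous_apply x₁).inner continuous_const).mul (((continuous_apply x₂).inner continuous_const).mul
      (((continuous_apply x₃).inner continuous_const).mul ((continuous_apply x₄).inner continuous_const))))
    (K := ‖v₁‖ * ‖v₂‖ * ‖v₃‖ * ‖v₄‖) (κ := (4 : ℕ)) fun φ => ?_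
  rw [abs_mul, abs_mul, abs_mul]
  calc |⟪φ x₁, v₁⟫_ℝ| * (|⟪φ x₂, v₂⟫_ℝ| * (|⟪φ x₃, v₃⟫_ℝ| * |⟪φ x₄, v₄⟫_ℝ|))
      ≤ (‖v₁‖ * ‖φ‖) * ((‖v₂‖ * ‖φ‖) * ((‖v₃‖ * ‖φ‖) * (‖v₄‖ * ‖φ‖))) :=
        mul_le_mul (abs_inner_apply_le φ _ _) (mul_le_mul (abs_inner_apply_le φ _ _)
          (mul_le_mul (abs_inner_apply_le φ _ _) (abs_inner_apply_le φ _ _) (abs_nonneg _) (by positivity))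
          (by positivity) (by positivity)) (by positivity) (by positivity)
    _ = ‖v₁‖ * ‖v₂‖ * ‖v₃‖ * ‖v₄‖ * ‖φ‖ ^ 4 := by ring
    _ ≤ ‖v₁‖ * ‖v₂‖ * ‖v₃‖ * ‖v₄‖ * Real.exp ((4 : ℕ) * ‖φ‖) :=
        mul_le_mul_of_nonneg_left (pow_norm_le_exp φ 4) (by positivity)

/-- `|⟪φ(x),Qφ(y)⟫| ≤ ‖Q‖·sup|φ|²`. [cite: Balaban1983Higgs3, (2.26) p.431] -/
theorem abs_inner_op_apply_le (φ : Cfg P j N) (x y : Site P j) (Q : EuclideanSpace ℝ (Fin N) →L[ℝ] EuclideanSpace ℝ (Fin N)) :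
    |⟪φ x, Q (φ y)⟫_ℝ| ≤ ‖Q‖ * ‖φ‖ ^ 2 :=
  calc |⟪φ x, Q (φ y)⟫_ℝ| ≤ ‖φ x‖ * ‖Q (φ y)‖ := abs_real_inner_le_norm _ _
    _ ≤ ‖φ‖ * (‖Q‖ * ‖φ‖) := mul_le_mul (norm_le_pi_norm φ x) ((Q.le_opNorm _).trans
        (mul_le_mul_of_nonneg_left (norm_le_pi_norm φ y) (norm_nonneg _))) (norm_nonneg _) (norm_nonneg _)
    _ = ‖Q‖ * ‖φ‖ ^ 2 := by ring

/-- `e^{−½⟨φ,Kφ⟩}⟪φ(x),Qφ(y)⟫` is integrable. [cite: Balaban1983Higgs3, (2.26) p.431] -/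
theorem integrable_weight_mul_inner_op (hw : 0 < w) (hM : 0 < M2) (x y : Site P j)
    (Q : EuclideanSpace ℝ (Fin N) →L[ℝ] EuclideanSpace ℝ (Fin N)) :
    Integrable (fun φ => weight C η w c M2 (0 : VecField P j ℝ) φ * ⟪φ x, Q (φ y)⟫_ℝ) :=
  integrable_weight_mul C η w c M2 hw hM ((continuous_apply x).inner (Q.continuous.comp (continuous_apply y)))
    (K := ‖Q‖) (κ := (2 : ℕ)) fun φ => (abs_inner_op_apply_le φ x y Q).trans
      (mul_le_mul_of_nonneg_left (pow_norm_le_exp φ 2) (norm_nonneg _))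

/-- `e^{−½⟨φ,Kφ⟩}⟪φ(x₁),qφ(y₁)⟫⟪φ(x₂),qφ(y₂)⟫` is integrable. [cite: Balaban1983Higgs3, (2.26) p.431] -/
theorem integrable_weight_mul_qq (hw : 0 < w) (hM : 0 < M2) (x₁ y₁ x₂ y₂ : Site P j) :
    Integrable (fun φ => weight C η w c M2 (0 : VecField P j ℝ) φ * (⟪φ x₁, C.q (φ y₁)⟫_ℝ * ⟪φ x₂, C.q (φ y₂)⟫_ℝ)) := by
  refine integrable_weight_mul C η w c M2 hw hM (((continuous_apply x₁).inner (C.q.continuous.comp (continuous_apply y₁))).mul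
    ((continuous_apply x₂).inner (C.q.continuous.comp (continuous_apply y₂)))) (K := ‖C.q‖ * ‖C.q‖) (κ := (4 : ℕ)) fun φ => ?_
  rw [abs_mul]
  calc |⟪φ x₁, C.q (φ y₁)⟫_ℝ| * |⟪φ x₂, C.q (φ y₂)⟫_ℝ| ≤ (‖C.q‖ * ‖φ‖ ^ 2) * (‖C.q‖ * ‖φ‖ ^ 2) :=
        mul_le_mul (abs_inner_op_apply_le φ _ _ _) (abs_inner_op_apply_le φ _ _ _) (abs_nonneg _) (by positivity)
    _ = ‖C.q‖ * ‖C.q‖ * ‖φ‖ ^ 4 := by ring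
    _ ≤ ‖C.q‖ * ‖C.q‖ * Real.exp ((4 : ℕ) * ‖φ‖) := mul_le_mul_of_nonneg_left (pow_norm_le_exp φ 4) (by positivity)

/-! ## §2 Wick's theorem for four fields -/

/-- **Fourth moments of `dμ_{C^η_{M²}}` (Wick)**: for `ℓ_a(φ) = ⟪φ(x_a),v_a⟫` and `c_{ab} = C^η_{M²}(x_a,x_b)⟪v_a,v_b⟫`,
`∫dφ e^{−½⟨φ,Kφ⟩}ℓ₁ℓ₂ℓ₃ℓ₄ = Z·(c₁₂c₃₄ + c₁₃c₂₄ + c₁₄c₂₃)` — Gaussian integration by parts (`B3WTCovariance.gaussIBP`) in the direction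
`C(·,x₁)⊗v₁` applied to `g = ℓ₂ℓ₃ℓ₄`, then the covariance (`B3WTCovariance.moment2`) three times. [cite: Balaban1983Higgs3, (2.26) p.431] -/
theorem moment4 (hw : 0 < w) (hM : 0 < M2) (x₁ x₂ x₃ x₄ : Site P j) (v₁ v₂ v₃ v₄ : EuclideanSpace ℝ (Fin N)) :
    ∫ φ, weight C η w c M2 (0 : VecField P j ℝ) φ * (⟪φ x₁, v₁⟫_ℝ * (⟪φ x₂, v₂⟫_ℝ * (⟪φ x₃, v₃⟫_ℝ * ⟪φ x₄, v₄⟫_ℝ))) =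
      (∫ φ, weight C η w c M2 (0 : VecField P j ℝ) φ) *
        (G w c M2 x₁ x₂ * ⟪v₁, v₂⟫_ℝ * (G w c M2 x₃ x₄ * ⟪v₃, v₄⟫_ℝ)
          + G w c M2 x₁ x₃ * ⟪v₁, v₃⟫_ℝ * (G w c M2 x₂ x₄ * ⟪v₂, v₄⟫_ℝ)
          + G w c M2 x₁ x₄ * ⟪v₁, v₄⟫_ℝ * (G w c M2 x₂ x₃ * ⟪v₂, v₃⟫_ℝ)) := by
  set h : Cfg P j N := gcol w c M2 x₁ v₁ with hh
  set l₂ : ℝ := ⟪h x₂, v₂⟫_ℝ with hl₂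
  set l₃ : ℝ := ⟪h x₃, v₃⟫_ℝ with hl₃
  set l₄ : ℝ := ⟪h x₄, v₄⟫_ℝ with hl₄
  set g : Cfg P j N → ℝ := fun φ => ⟪φ x₂, v₂⟫_ℝ * (⟪φ x₃, v₃⟫_ℝ * ⟪φ x₄, v₄⟫_ℝ) with hg
  set g' : Cfg P j N → ℝ := fun φ =>
    l₂ * (⟪φ x₃, v₃⟫_ℝ * ⟪φ x₄, v₄⟫_ℝ) + ⟪φ x₂, v₂⟫_ℝ * (l₃ * ⟪φ x₄, v₄⟫_ℝ + ⟪φ x₃, v₃⟫_ℝ * l₄) with hg'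
  have hV : 0 ≤ ‖v₂‖ * ‖v₃‖ * ‖v₄‖ := by positivity
  have hla : ∀ (x : Site P j) (v : EuclideanSpace ℝ (Fin N)), |⟪h x, v⟫_ℝ| ≤ ‖v‖ * ‖h‖ := fun x v => abs_inner_apply_le h x v
  have hmain := gaussIBP C η w c M2 hw hM h g g' (fun φ s => by
      simp only [hg, hg']
      exact (hasDerivAt_inner_transl φ h x₂ v₂ s).mul
        ((hasDerivAt_inner_transl φ h x₃ v₃ s).mul (hasDerivAt_inner_transl φ h x₄ v₄ s)))
    (((continuous_apply x₂).inner continuous_const).mul (((continuous_apply x₃).inner continuous_const).mul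
      ((continuous_apply x₄).inner continuous_const)))
    ((continuous_const.mul (((continuous_apply x₃).inner continuous_const).mul ((continuous_apply x₄).inner
      continuous_const))).add (((continuous_apply x₂).inner continuous_const).mul ((continuous_const.mul
      ((continuous_apply x₄).inner continuous_const)).add (((continuous_apply x₃).inner continuous_const).mul
      continuous_const))))
    (K := ‖v₂‖ * ‖v₃‖ * ‖v₄‖ * (1 + 3 * ‖h‖)) (κ := (3 : ℕ)) (by positivity)
    (fun φ => by
      simp only [hg]
      rw [abs_mul, abs_mul]
      calc |⟪φ x₂, v₂⟫_ℝ| * (|⟪φ x₃, v₃⟫_ℝ| * |⟪φ x₄, v₄⟫_ℝ|) ≤ (‖v₂‖ * ‖φ‖) * ((‖v₃‖ * ‖φ‖) * (‖v₄‖ * ‖φ‖)) :=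
            mul_le_mul (abs_inner_apply_le φ _ _) (mul_le_mul (abs_inner_apply_le φ _ _) (abs_inner_apply_le φ _ _)
              (abs_nonneg _) (by positivity)) (by positivity) (by positivity)
        _ = ‖v₂‖ * ‖v₃‖ * ‖v₄‖ * ‖φ‖ ^ 3 := by ring
        _ ≤ ‖v₂‖ * ‖v₃‖ * ‖v₄‖ * Real.exp ((3 : ℕ) * ‖φ‖) := mul_le_mul_of_nonneg_left (pow_norm_le_exp φ 3) hV
        _ ≤ ‖v₂‖ * ‖v₃‖ * ‖v₄‖ * (1 + 3 * ‖h‖) * Real.exp ((3 : ℕ) * ‖φ‖) := by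
            rw [mul_assoc (‖v₂‖ * ‖v₃‖ * ‖v₄‖) (1 + 3 * ‖h‖)]
            refine mul_le_mul_of_nonneg_left ?_ hV
            nlinarith [Real.exp_pos ((3 : ℕ) * ‖φ‖), norm_nonneg h])
    (fun φ => by
      simp only [hg']
      have e2 : ‖φ‖ ^ 2 ≤ Real.exp ((3 : ℕ) * ‖φ‖) :=
        (pow_norm_le_exp φ 2).trans (Real.exp_le_exp.mpr (by push_cast; nlinarith [norm_nonneg φ]))
      have i2 := abs_inner_apply_le φ x₂ v₂
      have i3 := abs_inner_apply_le φ x₃ v₃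
      have i4 := abs_inner_apply_le φ x₄ v₄
      have t : |l₂ * (⟪φ x₃, v₃⟫_ℝ * ⟪φ x₄, v₄⟫_ℝ) + ⟪φ x₂, v₂⟫_ℝ * (l₃ * ⟪φ x₄, v₄⟫_ℝ + ⟪φ x₃, v₃⟫_ℝ * l₄)|
          ≤ (‖v₂‖ * ‖h‖) * ((‖v₃‖ * ‖φ‖) * (‖v₄‖ * ‖φ‖))
            + (‖v₂‖ * ‖φ‖) * ((‖v₃‖ * ‖h‖) * (‖v₄‖ * ‖φ‖) + (‖v₃‖ * ‖φ‖) * (‖v₄‖ * ‖h‖)) := by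
        refine (abs_add_le _ _).trans (add_le_add ?_ ?_)
        · rw [abs_mul, abs_mul]
          exact mul_le_mul (hla _ _) (mul_le_mul i3 i4 (abs_nonneg _) (by positivity)) (by positivity) (by positivity)
        · rw [abs_mul]
          refine mul_le_mul i2 ((abs_add_le _ _).trans (add_le_add ?_ ?_)) (abs_nonneg _) (by positivity)
          · rw [abs_mul]; exact mul_le_mul (hla _ _) i4 (abs_nonneg _) (by positivity)
          · rw [abs_mul]; exact mul_le_mul i3 (hla _ _) (abs_nonneg _) (by positivity)
      refine t.trans ?_
      calc (‖v₂‖ * ‖h‖) * ((‖v₃‖ * ‖φ‖) * (‖v₄‖ * ‖φ‖))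
            + (‖v₂‖ * ‖φ‖) * ((‖v₃‖ * ‖h‖) * (‖v₄‖ * ‖φ‖) + (‖v₃‖ * ‖φ‖) * (‖v₄‖ * ‖h‖))
          = ‖v₂‖ * ‖v₃‖ * ‖v₄‖ * (3 * ‖h‖) * ‖φ‖ ^ 2 := by ring
        _ ≤ ‖v₂‖ * ‖v₃‖ * ‖v₄‖ * (3 * ‖h‖) * Real.exp ((3 : ℕ) * ‖φ‖) := mul_le_mul_of_nonneg_left e2 (by positivity)
        _ ≤ ‖v₂‖ * ‖v₃‖ * ‖v₄‖ * (1 + 3 * ‖h‖) * Real.exp ((3 : ℕ) * ‖φ‖) :=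
            mul_le_mul_of_nonneg_right (mul_le_mul_of_nonneg_left (by linarith [norm_nonneg h]) hV) (Real.exp_pos _).le)
  -- left side: `ℓ₁ = ⟨φ, K h⟩`
  have hlhs : (fun φ : Cfg P j N => weight C η w c M2 (0 : VecField P j ℝ) φ *
      (⟪φ x₁, v₁⟫_ℝ * (⟪φ x₂, v₂⟫_ℝ * (⟪φ x₃, v₃⟫_ℝ * ⟪φ x₄, v₄⟫_ℝ)))) =
      fun φ => weight C η w c M2 (0 : VecField P j ℝ) φ * (Kbil w c M2 φ h * g φ) := by
    funext φ
    rw [hh, Kbil_gcol w c M2 hw hM]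
  rw [hlhs, hmain]
  -- right side: split `∫ W g'` and use the covariance three times
  have i34 : Integrable (fun φ => l₂ * (weight C η w c M2 (0 : VecField P j ℝ) φ * (⟪φ x₃, v₃⟫_ℝ * ⟪φ x₄, v₄⟫_ℝ))) :=
    (integrable_weight_mul_inner_inner C η w c M2 hw hM x₃ x₄ v₃ v₄).const_mul l₂
  have i24 : Integrable (fun φ => l₃ * (weight C η w c M2 (0 : VecField P j ℝ) φ * (⟪φ x₂, v₂⟫_ℝ * ⟪φ x₄, v₄⟫_ℝ))) :=
    (integrable_weight_mul_inner_inner C η w c M2 hw hM x₂ x₄ v₂ v₄).const_mul l₃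
  have i23 : Integrable (fun φ => l₄ * (weight C η w c M2 (0 : VecField P j ℝ) φ * (⟪φ x₂, v₂⟫_ℝ * ⟪φ x₃, v₃⟫_ℝ))) :=
    (integrable_weight_mul_inner_inner C η w c M2 hw hM x₂ x₃ v₂ v₃).const_mul l₄
  have i1 : Integrable (fun φ => l₂ * (weight C η w c M2 (0 : VecField P j ℝ) φ * (⟪φ x₃, v₃⟫_ℝ * ⟪φ x₄, v₄⟫_ℝ))
      + l₃ * (weight C η w c M2 (0 : VecField P j ℝ) φ * (⟪φ x₂, v₂⟫_ℝ * ⟪φ x₄, v₄⟫_ℝ))) := i34.add i24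
  have hsplit : (fun φ : Cfg P j N => weight C η w c M2 (0 : VecField P j ℝ) φ * g' φ) = fun φ =>
      l₂ * (weight C η w c M2 (0 : VecField P j ℝ) φ * (⟪φ x₃, v₃⟫_ℝ * ⟪φ x₄, v₄⟫_ℝ))
        + l₃ * (weight C η w c M2 (0 : VecField P j ℝ) φ * (⟪φ x₂, v₂⟫_ℝ * ⟪φ x₄, v₄⟫_ℝ))
        + l₄ * (weight C η w c M2 (0 : VecField P j ℝ) φ * (⟪φ x₂, v₂⟫_ℝ * ⟪φ x₃, v₃⟫_ℝ)) := by
    funext φ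
    simp only [hg']
    ring
  rw [hsplit, integral_add i1 i23, integral_add i34 i24, integral_const_mul, integral_const_mul, integral_const_mul,
    moment2 C η w c M2 hw hM, moment2 C η w c M2 hw hM, moment2 C η w c M2 hw hM]
  simp only [hl₂, hl₃, hl₄, hh, gcol, real_inner_smul_left]
  rw [G_symm w c M2 x₂ x₁, G_symm w c M2 x₃ x₁, G_symm w c M2 x₄ x₁]
  ring

/-! ## §3 The `q`-contraction of two quadratic functionals -/

/-- `⟪a, qb⟫ = −Σ_i ⟪a,e_i⟫⟪b,qe_i⟫` over the standard orthonormal basis (antisymmetry of `q`). [cite: Balaban1982Higgs1, (1.7) p.605] -/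
theorem inner_q_expand (a b : EuclideanSpace ℝ (Fin N)) :
    ⟪a, C.q b⟫_ℝ = -∑ i : Fin N, ⟪a, EuclideanSpace.basisFun (Fin N) ℝ i⟫_ℝ * ⟪b, C.q (EuclideanSpace.basisFun (Fin N) ℝ i)⟫_ℝ := by
  rw [← (EuclideanSpace.basisFun (Fin N) ℝ).sum_inner_mul_inner a (C.q b), ← Finset.sum_neg_distrib]
  refine Finset.sum_congr rfl fun i _ => ?_
  rw [← real_inner_comm b, inner_q_left, real_inner_comm]
  ring

/-- `Σ_iΣ_k ⟪e_i,e_k⟫⟪qe_i,qe_k⟫ = −tr q²` (`tr(qq*) = −tr q²`). [cite: Balaban1983Higgs3, (2.26) p.431] -/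
theorem sum_inner_mul_inner_qq :
    ∑ i : Fin N, ∑ k : Fin N, ⟪EuclideanSpace.basisFun (Fin N) ℝ i, EuclideanSpace.basisFun (Fin N) ℝ k⟫_ℝ *
      ⟪C.q (EuclideanSpace.basisFun (Fin N) ℝ i), C.q (EuclideanSpace.basisFun (Fin N) ℝ k)⟫_ℝ = -trE (C.q.comp C.q) := by
  set e := EuclideanSpace.basisFun (Fin N) ℝ with he
  rw [trE, ← he, ← Finset.sum_neg_distrib]
  refine Finset.sum_congr rfl fun i _ => ?_
  have h1 : ∀ k, ⟪C.q (e i), C.q (e k)⟫_ℝ = ⟪e k, ContinuousLinearMap.adjoint C.q (C.q (e i))⟫_ℝ := fun k => by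
    rw [ContinuousLinearMap.adjoint_inner_right, real_inner_comm]
  simp_rw [h1]
  rw [e.sum_inner_mul_inner, ContinuousLinearMap.adjoint_inner_right, inner_q_q_self, ContinuousLinearMap.comp_apply]

/-- `Σ_iΣ_k ⟪e_i,qe_k⟫⟪qe_i,e_k⟫ = tr q²`. [cite: Balaban1983Higgs3, (2.26) p.431] -/
theorem sum_inner_mul_inner_q_q :
    ∑ i : Fin N, ∑ k : Fin N, ⟪EuclideanSpace.basisFun (Fin N) ℝ i, C.q (EuclideanSpace.basisFun (Fin N) ℝ k)⟫_ℝ *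
      ⟪C.q (EuclideanSpace.basisFun (Fin N) ℝ i), EuclideanSpace.basisFun (Fin N) ℝ k⟫_ℝ = trE (C.q.comp C.q) := by
  set e := EuclideanSpace.basisFun (Fin N) ℝ with he
  rw [trE, ← he]
  refine Finset.sum_congr rfl fun i _ => ?_
  have h1 : ∀ k, ⟪e i, C.q (e k)⟫_ℝ * ⟪C.q (e i), e k⟫_ℝ = ⟪C.q (e i), e k⟫_ℝ * ⟪e k, ContinuousLinearMap.adjoint C.q (e i)⟫_ℝ :=
    fun k => by rw [← ContinuousLinearMap.adjoint_inner_left, real_inner_comm (e k), mul_comm]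
  simp_rw [h1]
  rw [e.sum_inner_mul_inner, ContinuousLinearMap.adjoint_inner_right, real_inner_comm, ContinuousLinearMap.comp_apply]

/-- **The two-propagator contraction of (2.26)**: `∫dφ e^{−½⟨φ,Kφ⟩}⟪φ(x₁),qφ(y₁)⟫⟪φ(x₂),qφ(y₂)⟫
= Z·tr q²·(C(x₁,y₂)C(y₁,x₂) − C(x₁,x₂)C(y₁,y₂))` — the self-contraction of each factor vanishes (`⟪e,qe⟫ = 0`), the cross
contractions give `−tr q²·C(x₁,x₂)C(y₁,y₂)` and `+tr q²·C(x₁,y₂)C(y₁,x₂)`. [cite: Balaban1983Higgs3, (2.26) p.431] -/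
theorem moment_qq (hw : 0 < w) (hM : 0 < M2) (x₁ y₁ x₂ y₂ : Site P j) :
    ∫ φ, weight C η w c M2 (0 : VecField P j ℝ) φ * (⟪φ x₁, C.q (φ y₁)⟫_ℝ * ⟪φ x₂, C.q (φ y₂)⟫_ℝ) =
      (∫ φ, weight C η w c M2 (0 : VecField P j ℝ) φ) *
        (trE (C.q.comp C.q) * (G w c M2 x₁ y₂ * G w c M2 y₁ x₂ - G w c M2 x₁ x₂ * G w c M2 y₁ y₂)) := by
  have hexp : ∀ φ : Cfg P j N, weight C η w c M2 (0 : VecField P j ℝ) φ * (⟪φ x₁, C.q (φ y₁)⟫_ℝ * ⟪φ x₂, C.q (φ y₂)⟫_ℝ) =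
      ∑ i : Fin N, ∑ k : Fin N, weight C η w c M2 (0 : VecField P j ℝ) φ *
        (⟪φ x₁, EuclideanSpace.basisFun (Fin N) ℝ i⟫_ℝ * (⟪φ y₁, C.q (EuclideanSpace.basisFun (Fin N) ℝ i)⟫_ℝ *
          (⟪φ x₂, EuclideanSpace.basisFun (Fin N) ℝ k⟫_ℝ * ⟪φ y₂, C.q (EuclideanSpace.basisFun (Fin N) ℝ k)⟫_ℝ))) := by
    intro φ
    rw [inner_q_expand C (φ x₁), inner_q_expand C (φ x₂), neg_mul_neg, Finset.sum_mul_sum, Finset.mul_sum]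
    refine Finset.sum_congr rfl fun i _ => ?_
    rw [Finset.mul_sum]
    refine Finset.sum_congr rfl fun k _ => ?_
    ring
  have hint : ∀ i k : Fin N, Integrable (fun φ => weight C η w c M2 (0 : VecField P j ℝ) φ *
      (⟪φ x₁, EuclideanSpace.basisFun (Fin N) ℝ i⟫_ℝ * (⟪φ y₁, C.q (EuclideanSpace.basisFun (Fin N) ℝ i)⟫_ℝ *
        (⟪φ x₂, EuclideanSpace.basisFun (Fin N) ℝ k⟫_ℝ * ⟪φ y₂, C.q (EuclideanSpace.basisFun (Fin N) ℝ k)⟫_ℝ)))) :=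
    fun i k => integrable_weight_mul_inner4 C η w c M2 hw hM _ _ _ _ _ _ _ _
  have hik : ∀ i k : Fin N, ∫ φ, weight C η w c M2 (0 : VecField P j ℝ) φ *
      (⟪φ x₁, EuclideanSpace.basisFun (Fin N) ℝ i⟫_ℝ * (⟪φ y₁, C.q (EuclideanSpace.basisFun (Fin N) ℝ i)⟫_ℝ *
        (⟪φ x₂, EuclideanSpace.basisFun (Fin N) ℝ k⟫_ℝ * ⟪φ y₂, C.q (EuclideanSpace.basisFun (Fin N) ℝ k)⟫_ℝ))) =
      (∫ φ, weight C η w c M2 (0 : VecField P j ℝ) φ) *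
        ((G w c M2 x₁ x₂ * G w c M2 y₁ y₂) * (⟪EuclideanSpace.basisFun (Fin N) ℝ i, EuclideanSpace.basisFun (Fin N) ℝ k⟫_ℝ *
            ⟪C.q (EuclideanSpace.basisFun (Fin N) ℝ i), C.q (EuclideanSpace.basisFun (Fin N) ℝ k)⟫_ℝ)
          + (G w c M2 x₁ y₂ * G w c M2 y₁ x₂) * (⟪EuclideanSpace.basisFun (Fin N) ℝ i, C.q (EuclideanSpace.basisFun (Fin N) ℝ k)⟫_ℝ *
            ⟪C.q (EuclideanSpace.basisFun (Fin N) ℝ i), EuclideanSpace.basisFun (Fin N) ℝ k⟫_ℝ)) := by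
    intro i k
    rw [moment4 C η w c M2 hw hM, inner_q_self]
    ring
  have hsum : ∫ φ, weight C η w c M2 (0 : VecField P j ℝ) φ * (⟪φ x₁, C.q (φ y₁)⟫_ℝ * ⟪φ x₂, C.q (φ y₂)⟫_ℝ) =
      ∑ i : Fin N, ∑ k : Fin N, ∫ φ, weight C η w c M2 (0 : VecField P j ℝ) φ *
        (⟪φ x₁, EuclideanSpace.basisFun (Fin N) ℝ i⟫_ℝ * (⟪φ y₁, C.q (EuclideanSpace.basisFun (Fin N) ℝ i)⟫_ℝ *
          (⟪φ x₂, EuclideanSpace.basisFun (Fin N) ℝ k⟫_ℝ * ⟪φ y₂, C.q (EuclideanSpace.basisFun (Fin N) ℝ k)⟫_ℝ))) := by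
    simp_rw [hexp]
    rw [integral_finsetSum _ (fun i _ => integrable_finsetSum _ fun k _ => hint i k)]
    exact Finset.sum_congr rfl fun i _ => integral_finsetSum _ fun k _ => hint i k
  rw [hsum]
  simp_rw [hik]
  simp only [mul_add, Finset.sum_add_distrib, ← Finset.mul_sum]
  rw [sum_inner_mul_inner_qq C, sum_inner_mul_inner_q_q C]
  ring

end Literature.MathematicalPhysics.QuantumFieldTheory.Balaban1983to89.B3WTWick

end
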